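import Summits.PneNP.PneNP.Theses.AperiodicTorus
import Literature.Computability.Complexity.CircuitLowerBounds

/-!
# Route AperiodicTorus — `FregeHardGivesFregeNotPolyBounded` (stmt-PneNP-2475)

Sanity glue: crux #2 (`FregeHardAperiodicTorus`-shape hypothesis: an untileable-tori tile set whose torus tautologies
have no polynomial-size proofs in any Frege system) implies that no Frege system is polynomially bounded.

The content is the correctness of the inline encoding: if `torusCNF n` is satisfiable then the `n`-torus is tileable
(`torusCNF_sound`: pick, in every cell, a tile whose variable is true — the "some tile" clauses — and read the matching
conditions off the incompatibility clauses), so for untileable tori `torusForm n = ¬ ofCNF (torusCNF n)` is a tautology;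
and `torusForm n` has size `O_t(n²)` (`torusCNF_length_le`, `torusCNF_width_le`, `size_ofCNF_le_of_width`). A polynomial
bound `p(size)` on proof size is then `≤ n^(3 deg p + 1)` for large `n`, contradicting "for every `k`, infinitely often
all proofs exceed `n^k`" (`not_isPolyBounded_of_hard_cnf_family`). [CookReckhow1979, §1 Def. 1.3]
-/

set_option linter.dupNamespace false -- `Summit.PneNP.PneNP.…`: summit = sub-problem name (D-0017 single-conjunct layout)

namespace Summit.PneNP.PneNP.Theorems

open Literature.Computability.Complexity Literature.Computability.MetaComplexity

/-! ### Size of `ofCNF` -/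

/-- The clause formula of a clause of length `ℓ` has size `≤ 3ℓ + 1`. [folklore] -/
theorem size_clauseFoldr_le (c : Clause ℕ) :
    (c.foldr (fun l d => PropForm.disj (if l.2 then PropForm.var l.1 else PropForm.neg (PropForm.var l.1)) d)
      (PropForm.const false)).size ≤ 3 * c.length + 1 := by
  induction c with
  | nil => simp [PropForm.size]
  | cons l c ih =>
    simp only [List.foldr_cons, PropForm.size, List.length_cons]
    have hl : (if l.2 then PropForm.var l.1 else PropForm.neg (PropForm.var l.1)).size ≤ 2 := by
      split_ifs <;> simp [PropForm.size]
    omega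

/-- **Size of a CNF formula**: if every clause of `φ` has length `≤ w` then `size (ofCNF φ) ≤ |φ|·(3w+2) + 1`.
[folklore] -/
theorem size_ofCNF_le_of_width {φ : CNF ℕ} {w : ℕ} (hw : ∀ c ∈ φ, c.length ≤ w) :
    (PropForm.ofCNF φ).size ≤ φ.length * (3 * w + 2) + 1 := by
  induction φ with
  | nil => simp [PropForm.ofCNF, PropForm.size]
  | cons c φ ih =>
    have hc := hw c (by simp)
    have ih' := ih fun c' hc' => hw c' (by simp [hc'])
    have hcs := size_clauseFoldr_le c
    simp only [PropForm.ofCNF, List.foldr_cons, PropForm.size, List.length_cons] at ih' hcs ⊢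
    nlinarith

/-! ### The torus encoding (abstract in the cell / pair lists and the variable numbering) -/

/-- **Soundness of the torus CNF**: a satisfying assignment of the torus clauses (some tile per cell; horizontal and
vertical incompatibility clauses) yields a tiling with matching colours. The variable numbering `v`, the successor
map `nx` and the (complete) cell / pair lists are arbitrary. [folklore] -/
theorem torusCNF_sound {t n : ℕ} (τ : Fin t → ℕ × ℕ × ℕ × ℕ) (v : Fin n → Fin n → Fin t → ℕ) (nx : Fin n → Fin n)
    (cells : List (Fin n × Fin n)) (prs : List (Fin t × Fin t)) (hcells : ∀ i j, (i, j) ∈ cells)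
    (hprs : ∀ s s', (s, s') ∈ prs) (σ : ℕ → Bool)
    (hσ : ∀ c ∈ (cells.map fun c => (List.finRange t).map fun s => (v c.1 c.2 s, true)) ++
        (cells.flatMap fun c => (prs.filter fun q => decide (q.1 < q.2)).map fun q =>
          [(v c.1 c.2 q.1, false), (v c.1 c.2 q.2, false)]) ++
        (cells.flatMap fun c => (prs.filter fun q => decide ((τ q.1).2.1 ≠ (τ q.2).2.2.2)).map fun q =>
          [(v c.1 c.2 q.1, false), (v c.1 (nx c.2) q.2, false)]) ++
        (cells.flatMap fun c => (prs.filter fun q => decide ((τ q.1).2.2.1 ≠ (τ q.2).1)).map fun q =>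
          [(v c.1 c.2 q.1, false), (v (nx c.1) c.2 q.2, false)]), Clause.eval σ c = true) :
    ∃ f : Fin n → Fin n → Fin t, ∀ i j : Fin n,
      (τ (f i j)).2.1 = (τ (f i (nx j))).2.2.2 ∧ (τ (f i j)).2.2.1 = (τ (f (nx i) j)).1 := by
  classical
  have hex : ∀ i j : Fin n, ∃ s : Fin t, σ (v i j s) = true := by
    intro i j
    have hmem := hσ ((List.finRange t).map fun s => (v i j s, true))
      (List.mem_append.2 (Or.inl (List.mem_append.2 (Or.inl (List.mem_append.2 (Or.inl
        (List.mem_map.2 ⟨(i, j), hcells i j, rfl⟩)))))))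
    simp only [Clause.eval] at hmem
    obtain ⟨l, hl, hlσ⟩ := List.any_eq_true.1 hmem
    obtain ⟨s, -, rfl⟩ := List.mem_map.1 hl
    exact ⟨s, by simpa [Literal.eval] using hlσ⟩
  choose f hf using hex
  refine ⟨f, fun i j => ⟨?_, ?_⟩⟩
  · by_contra hne
    have hmem := hσ [(v i j (f i j), false), (v i (nx j) (f i (nx j)), false)]
      (List.mem_append.2 (Or.inl (List.mem_append.2 (Or.inr (List.mem_flatMap.2
        ⟨(i, j), hcells i j, List.mem_map.2 ⟨(f i j, f i (nx j)),
          List.mem_filter.2 ⟨hprs _ _, decide_eq_true hne⟩, rfl⟩⟩)))))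
    simp [Clause.eval, Literal.eval, hf] at hmem
  · by_contra hne
    have hmem := hσ [(v i j (f i j), false), (v (nx i) j (f (nx i) j), false)]
      (List.mem_append.2 (Or.inr (List.mem_flatMap.2
        ⟨(i, j), hcells i j, List.mem_map.2 ⟨(f i j, f (nx i) j),
          List.mem_filter.2 ⟨hprs _ _, decide_eq_true hne⟩, rfl⟩⟩)))
    simp [Clause.eval, Literal.eval, hf] at hmem

/-- Every clause of the torus CNF has length `≤ t + 2`. [folklore] -/
theorem torusCNF_width_le {t n : ℕ} (τ : Fin t → ℕ × ℕ × ℕ × ℕ) (v : Fin n → Fin n → Fin t → ℕ) (nx : Fin n → Fin n)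
    (cells : List (Fin n × Fin n)) (prs : List (Fin t × Fin t)) :
    ∀ c ∈ (cells.map fun c => (List.finRange t).map fun s => (v c.1 c.2 s, true)) ++
        (cells.flatMap fun c => (prs.filter fun q => decide (q.1 < q.2)).map fun q =>
          [(v c.1 c.2 q.1, false), (v c.1 c.2 q.2, false)]) ++
        (cells.flatMap fun c => (prs.filter fun q => decide ((τ q.1).2.1 ≠ (τ q.2).2.2.2)).map fun q =>
          [(v c.1 c.2 q.1, false), (v c.1 (nx c.2) q.2, false)]) ++
        (cells.flatMap fun c => (prs.filter fun q => decide ((τ q.1).2.2.1 ≠ (τ q.2).1)).map fun q =>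
          [(v c.1 c.2 q.1, false), (v (nx c.1) c.2 q.2, false)]),
      c.length ≤ t + 2 := by
  intro c hc
  simp only [List.mem_append, List.mem_map, List.mem_flatMap, List.mem_filter] at hc
  rcases hc with ((⟨a, -, rfl⟩ | ⟨a, -, q, -, rfl⟩) | ⟨a, -, q, -, rfl⟩) | ⟨a, -, q, -, rfl⟩
  · simp
  all_goals simp

/-- The torus CNF has at most `|cells|·(1 + 3|prs|)` clauses. [folklore] -/
theorem torusCNF_length_le {t n : ℕ} (τ : Fin t → ℕ × ℕ × ℕ × ℕ) (v : Fin n → Fin n → Fin t → ℕ) (nx : Fin n → Fin n)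
    (cells : List (Fin n × Fin n)) (prs : List (Fin t × Fin t)) :
    ((cells.map fun c => (List.finRange t).map fun s => (v c.1 c.2 s, true)) ++
        (cells.flatMap fun c => (prs.filter fun q => decide (q.1 < q.2)).map fun q =>
          [(v c.1 c.2 q.1, false), (v c.1 c.2 q.2, false)]) ++
        (cells.flatMap fun c => (prs.filter fun q => decide ((τ q.1).2.1 ≠ (τ q.2).2.2.2)).map fun q =>
          [(v c.1 c.2 q.1, false), (v c.1 (nx c.2) q.2, false)]) ++
        (cells.flatMap fun c => (prs.filter fun q => decide ((τ q.1).2.2.1 ≠ (τ q.2).1)).map fun q =>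
          [(v c.1 c.2 q.1, false), (v (nx c.1) c.2 q.2, false)])).length
      ≤ cells.length * (1 + 3 * prs.length) := by
  have key : ∀ (g : Fin n × Fin n → List (Clause ℕ)), (∀ c, (g c).length ≤ prs.length) →
      (cells.flatMap g).length ≤ cells.length * prs.length := by
    intro g hg
    rw [List.length_flatMap]
    have h := List.sum_le_card_nsmul (cells.map fun a => (g a).length) prs.length
      (fun x hx => by obtain ⟨a, -, rfl⟩ := List.mem_map.1 hx; exact hg a)
    simpa [List.length_map] using h
  have hfl : ∀ (p : Fin t × Fin t → Bool) (h : Fin t × Fin t → Clause ℕ) (c : Fin n × Fin n),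
      (((prs.filter p).map h)).length ≤ prs.length := fun p h c => by
    rw [List.length_map]; exact List.length_filter_le _ _
  simp only [List.length_append, List.length_map]
  have h2 := key _ fun c => hfl (fun q => decide (q.1 < q.2)) (fun q => [(v c.1 c.2 q.1, false), (v c.1 c.2 q.2, false)]) c
  have h3 := key _ fun c => hfl (fun q => decide ((τ q.1).2.1 ≠ (τ q.2).2.2.2))
    (fun q => [(v c.1 c.2 q.1, false), (v c.1 (nx c.2) q.2, false)]) c
  have h4 := key _ fun c => hfl (fun q => decide ((τ q.1).2.2.1 ≠ (τ q.2).1))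
    (fun q => [(v c.1 c.2 q.1, false), (v (nx c.1) c.2 q.2, false)]) c
  nlinarith

/-! ### The analytic endgame -/

/-- **Hard CNF families defeat polynomial boundedness**: if the CNFs `Φ n` have formulas of size `≤ A·n² + B`, are
unsatisfiable for `n ≥ 1` (here: satisfiable only if the untileable torus tiles), and in every Frege system their
negations infinitely often need proofs larger than any fixed power of `n`, then no Frege system is polynomially bounded.
[cite: CookReckhow1979, §1 Def. 1.3] -/
theorem not_isPolyBounded_of_hard_cnf_family (tiles : ℕ → Prop) (Φ : ℕ → CNF ℕ) (A B : ℕ)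
    (hsound : ∀ n, 1 ≤ n → (Φ n).Satisfiable → tiles n)
    (hsize : ∀ n, (PropForm.ofCNF (Φ n)).size ≤ A * n ^ 2 + B)
    (h1 : ∀ n ≥ 1, ¬ tiles n)
    (h2 : ∀ F : FregeSystem, IsFrege F → ∀ k N : ℕ, ∃ n ≥ N, ∀ π : List (PropForm ℕ),
      F.IsProofOf π (PropForm.neg (PropForm.ofCNF (Φ n))) → n ^ k < proofSize π)
    (F : FregeSystem) (hF : IsFrege F) : ¬ F.IsPolyBounded := by
  rintro ⟨p, hp⟩
  have htaut : ∀ n, 1 ≤ n → (PropForm.neg (PropForm.ofCNF (Φ n))).IsTautology := by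
    intro n hn σ
    simp only [PropForm.eval, PropForm.eval_ofCNF]
    cases h : CNF.eval (Φ n) σ
    · rfl
    · exact absurd (hsound n hn ⟨σ, h⟩) (h1 n hn)
  obtain ⟨n, hnN, hn⟩ := h2 F hF (3 * p.natDegree + 1) (max (A + B + 2) (p.eval 1 + 1))
  have hAB : A + B + 2 ≤ n := (le_max_left _ _).trans hnN
  have hc : p.eval 1 + 1 ≤ n := (le_max_right _ _).trans hnN
  have hn1 : 1 ≤ n := by omega
  obtain ⟨π, hπ, hsizeπ⟩ := hp _ (htaut n hn1)
  have hlt := hn π hπ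
  have hsz : (PropForm.neg (PropForm.ofCNF (Φ n))).size ≤ n ^ 3 := by
    show (PropForm.ofCNF (Φ n)).size + 1 ≤ n ^ 3
    have h := hsize n
    have hn2 : 1 ≤ n ^ 2 := Nat.one_le_pow _ _ hn1
    calc (PropForm.ofCNF (Φ n)).size + 1 ≤ A * n ^ 2 + B + 1 := by omega
      _ ≤ (A + B + 1) * n ^ 2 := by nlinarith
      _ ≤ n * n ^ 2 := Nat.mul_le_mul_right _ (by omega)
      _ = n ^ 3 := by ring
  have h3 : proofSize π ≤ n ^ (3 * p.natDegree + 1) :=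
    calc proofSize π ≤ p.eval (PropForm.neg (PropForm.ofCNF (Φ n))).size := hsizeπ
      _ ≤ p.eval (n ^ 3) := natPoly_eval_mono p hsz
      _ ≤ p.eval 1 * (n ^ 3) ^ p.natDegree := natPoly_eval_le_eval_one_mul_pow p (Nat.one_le_pow _ _ hn1)
      _ ≤ n * (n ^ 3) ^ p.natDegree := Nat.mul_le_mul_right _ (by omega)
      _ = n ^ (3 * p.natDegree + 1) := by ring
  exact absurd hlt (not_lt.2 h3)

/-! ### The item -/

/-- **Support item `FregeHardGivesFregeNotPolyBounded` of route AperiodicTorus (stmt-PneNP-2475)**: crux #2 (untileable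
tori whose torus tautologies defeat every fixed power of `n` in every Frege system) implies that no Frege system is
polynomially bounded — `torusForm n` is a tautology iff the `n`-torus is untileable (encoding soundness) and has size
`O_t(n²)`. [cite: CookReckhow1979, §1 Def. 1.3] -/
theorem aperiodicTorus_fregeHardGivesFregeNotPolyBounded_proof :
    Summit.PneNP.PneNP.Theses.AperiodicTorus.FregeHardGivesFregeNotPolyBounded := by
  unfold Summit.PneNP.PneNP.Theses.AperiodicTorus.FregeHardGivesFregeNotPolyBounded
  rintro ⟨t, τ, h⟩ F hF
  refine not_isPolyBounded_of_hard_cnf_family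
    (fun n : ℕ => ∃ f : Fin n → Fin n → Fin t, ∀ i j : Fin n, (τ (f i j)).2.1 = (τ (f i ⟨(j.1 + 1) % n, Nat.mod_lt _ j.pos⟩)).2.2.2 ∧ (τ (f i j)).2.2.1 = (τ (f ⟨(i.1 + 1) % n, Nat.mod_lt _ i.pos⟩ j)).1)
    (fun n : ℕ => let v : Fin n → Fin n → Fin t → ℕ := fun i j s => (i.1 * n + j.1) * t + s.1; let nx : Fin n → Fin n := fun i => ⟨(i.1 + 1) % n, Nat.mod_lt _ i.pos⟩; let cells : List (Fin n × Fin n) := (List.finRange n).flatMap fun i => (List.finRange n).map fun j => (i, j); let prs : List (Fin t × Fin t) := (List.finRange t).flatMap fun s => (List.finRange t).map fun s' => (s, s'); (cells.map fun c => (List.finRange t).map fun s => (v c.1 c.2 s, true)) ++ (cells.flatMap fun c => (prs.filter fun q => decide (q.1 < q.2)).map fun q => [(v c.1 c.2 q.1, false), (v c.1 c.2 q.2, false)]) ++ (cells.flatMap fun c => (prs.filter fun q => decide ((τ q.1).2.1 ≠ (τ q.2).2.2.2)).map fun q => [(v c.1 c.2 q.1, false), (v c.1 (nx c.2) q.2,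 false)]) ++ (cells.flatMap fun c => (prs.filter fun q => decide ((τ q.1).2.2.1 ≠ (τ q.2).1)).map fun q => [(v c.1 c.2 q.1, false), (v (nx c.1) c.2 q.2, false)]))
    ((1 + 3 * (t * t)) * (3 * (t + 2) + 2)) 1 ?_ ?_ h.1 h.2 F hF
  · -- soundness of the encoding
    rintro n - ⟨σ, hσ⟩
    exact torusCNF_sound τ (fun i j s => (i.1 * n + j.1) * t + s.1) (fun i => ⟨(i.1 + 1) % n, Nat.mod_lt _ i.pos⟩)
      ((List.finRange n).flatMap fun i => (List.finRange n).map fun j => (i, j))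
      ((List.finRange t).flatMap fun s => (List.finRange t).map fun s' => (s, s'))
      (fun i j => by simp) (fun s s' => by simp) σ ((CNF.eval_eq_true_iff _ σ).1 hσ)
  · -- size of the encoding
    intro n
    have hw := torusCNF_width_le τ (fun i j s => (i.1 * n + j.1) * t + s.1) (fun i => ⟨(i.1 + 1) % n, Nat.mod_lt _ i.pos⟩)
      ((List.finRange n).flatMap fun i => (List.finRange n).map fun j => (i, j))
      ((List.finRange t).flatMap fun s => (List.finRange t).map fun s' => (s, s'))
    have hl := torusCNF_length_le τ (fun i j s => (i.1 * n + j.1) * t + s.1) (fun i => ⟨(i.1 + 1) % n, Nat.mod_lt _ i.pos⟩)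
      ((List.finRange n).flatMap fun i => (List.finRange n).map fun j => (i, j))
      ((List.finRange t).flatMap fun s => (List.finRange t).map fun s' => (s, s'))
    have hcells : ((List.finRange n).flatMap fun i => (List.finRange n).map fun j => (i, j)).length = n * n := by
      simp
    have hprs : ((List.finRange t).flatMap fun s => (List.finRange t).map fun s' => (s, s')).length = t * t := by
      simp
    rw [hcells, hprs] at hl
    refine (size_ofCNF_le_of_width hw).trans ?_
    have := Nat.mul_le_mul_right (3 * (t + 2) + 2) hl
    nlinarith [this]

end Summit.PneNP.PneNP.Theorems
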